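import Mathlib.LinearAlgebra.Dual.Defs
import Mathlib.LinearAlgebra.Determinant
import Mathlib.LinearAlgebra.FiniteDimensional.Lemmas
import Mathlib.Topology.Algebra.OpenSubgroup
import Mathlib.Topology.Algebra.Group.ClosedSubgroup
import Mathlib.LinearAlgebra.Prod
import Mathlib.RingTheory.Polynomial.Basic
import HarnessLib

/-!
# [AbsTopI] Lemma 4.5 (ii), (iii): the quasi-trivial rank `τ(M)`, `d_χ(M)`, and the characterisation
# of the cyclotomic character

S. Mochizuki, *Topics in Absolute Anabelian Geometry I: Generalities* [MochizukiAbsTopI2012];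
locators `p.N` = pages of the kurims manuscript (`paper:url-11ac98ba15fc`, 83 pp.; journal
pagination not held), read on the page: Lemma 4.5, pp. 53–55.  Cell abc-iut, layer L4: the "full
`ℚ_l[G]`-module form" of Lemma 4.5 (ii), (iii) that abc-iut-L4-t4's `AbsTopIChains.lean` left
untyped (there the cusp count `d` of (iii)/(iv) enters `CuspCountData` as a datum); this ADDITIVE
file supplies the character calculus defining it (hand-off from t4).  Nothing of t4's is
re-declared: where the content of t4's `IsQuasiTrivial` / `PowerEquivalent` /
`IsQCyclotomicOfWeight` (`AbsTopISemiAbsolute.lean`, not yet built; `ℤ_l^×`-valued) is needed it is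
written out for `Kˣ`-valued characters (inline, resp. `IsQCyclotomicOfWeightK`; TODO-merge t4).

Setting of (ii), p. 54: `M` "a finite-dimensional `ℚ_l`-vector space equipped with a continuous
`G`-action" — here a representation `ρ : G →* (M ≃ₗ[K] M)` over a field `K`; finite dimension,
continuity, a topology on `K` are hypotheses only where used.
* REAL DEFINITIONS: stable submodules; *quasi-trivial steps* `N' ≤ N` (an open subgroup of
  finite index acts trivially on `N/N'`, stated on the pair); stable chains; the **quasi-trivial
  rank** `quasiTrivialRank ρ = τ(M)` := the supremum over stable chains of the total dimension of
  the quasi-trivial steps.  The text defines `τ(M)` as this total "of ANY filtration [...] such that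
  each `M_j/M_{j+1}` is either quasi-trivial or has no nontrivial subquotients" ([CombGC] Def. 2.3
  (i)); by Jordan–Hölder all admissible filtrations give the same total, and refinement only moves
  dimension INTO quasi-trivial steps, so that common value is the supremum — a closed form needing
  no well-definedness lemma.  PROVED: each chain's total is `≤ τ(M) ≤ dim M`.
* the twist `M(χ)`, the dual `Hom_K(M, K)`, and `dChi ρ χ = d_χ(M) := τ(M(χ⁻¹)) − τ(Hom(M, K))`
  VERBATIM (p. 54).
* (ii)'s ASSERTION "`d_χ(M)` [...] depends only on the power-equivalence class of `χ`" — PROVED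
  (`dChi_eq_of_powerEquivalent`) for continuous characters: `χ₁ⁿ = χ₂ⁿ` makes `χ₂χ₁⁻¹` finite-valued
  (n-th roots of unity), hence with open kernel of finite index, and such a twist changes neither
  the stable submodules nor the quasi-trivial steps.
* (iii) (p. 54) — determinant character `ℚ`-cyclotomic of positive weight; max/min-weight
  characterisation of the power-equivalence class of `χ^{cyclo}`; cusp count `d_χ(H^{ab} ⊗ ℚ_l) + 1`
  — as PREDICATES on abstract data (typing policy θ): `V = H^{ab} ⊗ ℚ_l` is an INPUT representation
  (its construction from `H ⊆ Δ` belongs to the étale-`π₁` model, FOUNDATIONS row 12), `χ^{cyclo}`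
  an input character, the number of cusps an input (t4's `CuspCountData`); no closed `∃`-statement
  over such data is asserted (it would be refutable by junk data).
HONEST FRAMING: refereed pre-IUT anabelian geometry; nothing here bears on [IUTchIII] Cor. 3.12.
-/

noncomputable section

open scoped Classical

namespace Literature.AnabelianGeometry.AbsoluteAnabelian.AbsTopI

universe u v w w'

section Algebraic

variable {G : Type u} [Group G]
variable {K : Type v} [Field K] {M : Type w} [AddCommGroup M] [Module K M]

/-! ### Stable submodules, twists `M(χ)`, the dual `Hom(M, K)` -/

/-- A `K`-submodule `N ⊆ M` is *stable* under `ρ` (a "`ℚ_l[G]`-submodule", Lemma 4.5 (ii) p. 54).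
[cite: MochizukiAbsTopI2012, Lemma 4.5 (ii) p.54] -/
def IsStable (ρ : G →* (M ≃ₗ[K] M)) (N : Submodule K M) : Prop :=
  ∀ g : G, ∀ m ∈ N, ρ g m ∈ N

/-- The twist `M(χ)`: `g` acts by `χ(g)·ρ(g)` ("twisting `M` by the character", Lemma 4.5 (ii)
p. 54; the text twists by `χ⁻¹`, see `dChi`); characters are `Kˣ`-valued (for `χ : G → ℤ_l^×`
compose with `ℤ_l^× → ℚ_l^×`). [cite: MochizukiAbsTopI2012, Lemma 4.5 (ii) p.54] -/
def twist (ρ : G →* (M ≃ₗ[K] M)) (χ : G →* Kˣ) : G →* (M ≃ₗ[K] M) where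
  toFun g := LinearEquiv.smulOfUnit (χ g) * ρ g
  map_one' := by
    ext m
    show ((χ 1 : Kˣ) : K) • ρ 1 m = m
    simp
  map_mul' g h := by
    ext m
    show ((χ (g * h) : Kˣ) : K) • ρ (g * h) m = ((χ g : Kˣ) : K) • ρ g (((χ h : Kˣ) : K) • ρ h m)
    simp only [map_mul, LinearEquiv.mul_apply, map_smul, smul_smul, Units.val_mul]

/-- `(twist ρ χ) g m = χ(g) • ρ(g) m`. [cite: MochizukiAbsTopI2012, Lemma 4.5 (ii) p.54] -/
@[simp] theorem twist_apply (ρ : G →* (M ≃ₗ[K] M)) (χ : G →* Kˣ) (g : G) (m : M) :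
    twist ρ χ g m = (χ g : K) • ρ g m := rfl

/-- Twisting twice: `M(χ₁)(χ₂) = M(χ₁χ₂)`. [cite: MochizukiAbsTopI2012, Lemma 4.5 (ii) p.54] -/
theorem twist_twist (ρ : G →* (M ≃ₗ[K] M)) (χ₁ χ₂ : G →* Kˣ) :
    twist (twist ρ χ₁) χ₂ = twist ρ (χ₁ * χ₂) := by
  ext g m
  simp [smul_smul, mul_comm]

/-- Twisting by the trivial character does nothing. [cite: MochizukiAbsTopI2012, Lemma 4.5 (ii) p.54] -/
theorem twist_one (ρ : G →* (M ≃ₗ[K] M)) : twist ρ 1 = ρ := by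
  ext g m
  simp

/-- Twisting by a character does not change which submodules are stable.
[cite: MochizukiAbsTopI2012, Lemma 4.5 (ii) p.54] -/
theorem isStable_twist_iff (ρ : G →* (M ≃ₗ[K] M)) (χ : G →* Kˣ) (N : Submodule K M) :
    IsStable (twist ρ χ) N ↔ IsStable ρ N := by
  constructor
  · intro h g m hm
    have h1 := h g m hm
    rw [twist_apply] at h1
    have h2 := N.smul_mem ((χ g : K)⁻¹) h1
    rwa [smul_smul, inv_mul_cancel₀ (χ g).ne_zero, one_smul] at h2
  · intro h g m hm
    rw [twist_apply]
    exact N.smul_mem _ (h g m hm)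

/-- The dual representation `Hom_K(M, K)` ("`Hom_{ℚ_l}(M, ℚ_l)`", p. 54): `g` acts by `φ ↦ φ ∘ ρ(g⁻¹)`.
[cite: MochizukiAbsTopI2012, Lemma 4.5 (ii) p.54] -/
def dualRep (ρ : G →* (M ≃ₗ[K] M)) : G →* (Module.Dual K M ≃ₗ[K] Module.Dual K M) where
  toFun g := (ρ g⁻¹).dualMap
  map_one' := by
    ext φ m
    simp [LinearEquiv.dualMap_apply]
  map_mul' g h := by
    ext φ m
    simp [LinearEquiv.dualMap_apply, mul_inv_rev]

/-- `V ⊕ K` with the trivial action on `K` ("`(H^{ab} ⊗ ℚ_l) ⊕ ℚ_l` [where the final direct summand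
`ℚ_l` is equipped with the trivial `G`-action]", p. 54). [cite: MochizukiAbsTopI2012, Lemma 4.5 (iii) p.54] -/
def withTrivial (ρ : G →* (M ≃ₗ[K] M)) : G →* ((M × K) ≃ₗ[K] (M × K)) where
  toFun g := (ρ g).prodCongr (LinearEquiv.refl K K)
  map_one' := by
    ext x <;> simp
  map_mul' g h := by
    ext x <;> simp

/-- The determinant character `g ↦ det ρ(g)` ("the character [...] arising from the determinant",
p. 54). [cite: MochizukiAbsTopI2012, Lemma 4.5 (iii) p.54] -/
def detChar (ρ : G →* (M ≃ₗ[K] M)) : G →* Kˣ := LinearEquiv.det.comp ρ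

/-- `ℚ`-cyclotomic of weight `w` relative to `χ^{cyclo}`, written out for `Kˣ`-valued characters:
"there exist integers `a, b`, where `b > 0`, such that `χ^b = (χ^{cyclo})^a`, `w = 2a/b`"
([AbsTopI] Lemma 4.5 preamble p. 54, from [Mzk12] Def. 2.3; = abc-iut-L4-t4's `IsQCyclotomicOfWeight`
for `ℤ_l^×`-valued characters; TODO-merge). [cite: MochizukiAbsTopI2012, Lemma 4.5 p.54] -/
def IsQCyclotomicOfWeightK (χcyclo χ : G →* Kˣ) (w : ℚ) : Prop :=
  ∃ a b : ℤ, 0 < b ∧ (∀ g : G, χ g ^ b = χcyclo g ^ a) ∧ w = 2 * a / b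

end Algebraic

section Topological

variable {G : Type u} [Group G] [TopologicalSpace G]
variable {K : Type v} [Field K] {M : Type w} [AddCommGroup M] [Module K M]

/-! ### Quasi-trivial steps, stable chains, `τ(M)` -/

/-- The step `N' ≤ N` is *quasi-trivial*: the action on `N/N'` "factors through a finite quotient of
`G`" — an open subgroup of finite index moves every `m ∈ N` within its coset mod `N'` (t4's
`IsQuasiTrivial` for the subquotient, stated on the pair). [cite: MochizukiAbsTopI2012, Lemma 4.5 (ii) p.54] -/
def IsQuasiTrivialStep (ρ : G →* (M ≃ₗ[K] M)) (N N' : Submodule K M) : Prop :=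
  ∃ U : Subgroup G, IsOpen (U : Set G) ∧ U.FiniteIndex ∧ ∀ g ∈ U, ∀ m ∈ N, ρ g m - m ∈ N'

/-- The step `N' ≤ N` "has no nontrivial subquotients": no stable submodule strictly in between.
[cite: MochizukiAbsTopI2012, Lemma 4.5 (ii) p.54] -/
def IsSimpleStep (ρ : G →* (M ≃ₗ[K] M)) (N N' : Submodule K M) : Prop :=
  N' < N ∧ ∀ P : Submodule K M, IsStable ρ P → N' ≤ P → P ≤ N → P = N' ∨ P = N

/-- A filtration "`M_n ⊆ ... ⊆ M_j ⊆ ... M_0 = M` of `M` by `ℚ_l[G]`-modules", `M_n = 0` (p. 54),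
indexed by `ℕ` (terms beyond `length` are irrelevant). [cite: MochizukiAbsTopI2012, Lemma 4.5 (ii) p.54] -/
structure StableChain (ρ : G →* (M ≃ₗ[K] M)) where
  /-- the length `n` -/
  length : ℕ
  /-- the terms `M_0, M_1, …` -/
  term : ℕ → Submodule K M
  /-- `M_0 = M` -/
  term_zero : term 0 = ⊤
  /-- `M_n = 0` -/
  term_length : term length = ⊥
  /-- `M_{j+1} ⊆ M_j` -/
  step_le : ∀ j < length, term (j + 1) ≤ term j
  /-- each `M_j` is a `ℚ_l[G]`-submodule -/
  stable : ∀ j, IsStable ρ (term j)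

/-- Admissibility (p. 54): "each `M_j/M_{j+1}` is either quasi-trivial or has no nontrivial
subquotients". [cite: MochizukiAbsTopI2012, Lemma 4.5 (ii) p.54] -/
def StableChain.IsAdmissible {ρ : G →* (M ≃ₗ[K] M)} (c : StableChain ρ) : Prop :=
  ∀ j < c.length, IsQuasiTrivialStep ρ (c.term j) (c.term (j + 1)) ∨
    IsSimpleStep ρ (c.term j) (c.term (j + 1))

/-- "the sum of the `ℚ_l`-dimensions of the quasi-trivial subquotients `M_j/M_{j+1}`" (p. 54).
[cite: MochizukiAbsTopI2012, Lemma 4.5 (ii) p.54] -/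
def StableChain.qtDim {ρ : G →* (M ≃ₗ[K] M)} (c : StableChain ρ) : ℕ :=
  ∑ j ∈ Finset.range c.length,
    if IsQuasiTrivialStep ρ (c.term j) (c.term (j + 1)) then
      Module.finrank K (c.term j) - Module.finrank K (c.term (j + 1)) else 0

/-- The trivial filtration `M ⊇ 0`. [cite: MochizukiAbsTopI2012, Lemma 4.5 (ii) p.54] -/
def StableChain.trivial (ρ : G →* (M ≃ₗ[K] M)) : StableChain ρ where
  length := 1
  term j := if j = 0 then ⊤ else ⊥
  term_zero := by simp
  term_length := by simp
  step_le j _ := by simp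
  stable j g m hm := by
    by_cases hj : j = 0
    · subst hj; simp
    · simp only [hj, if_false, Submodule.mem_bot] at hm ⊢
      rw [hm, map_zero]

/-- **The quasi-trivial rank `τ(M)`** (Lemma 4.5 (ii) p. 54, [CombGC] Def. 2.3 (i)): the supremum
over stable filtrations of the total dimension of their quasi-trivial steps (= the printed "sum
[...] of any [admissible] filtration", see the module docstring). [cite: MochizukiAbsTopI2012, Lemma 4.5 (ii) p.54] -/
def quasiTrivialRank (ρ : G →* (M ≃ₗ[K] M)) : ℕ :=
  sSup (Set.range (StableChain.qtDim (ρ := ρ)))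

/-- The quasi-trivial part of a filtration has dimension `≤ dim M` (telescoping).
[cite: MochizukiAbsTopI2012, Lemma 4.5 (ii) p.54] -/
theorem StableChain.qtDim_le [FiniteDimensional K M] {ρ : G →* (M ≃ₗ[K] M)} (c : StableChain ρ) :
    c.qtDim ≤ Module.finrank K M := by
  set f : ℕ → ℕ := fun j => Module.finrank K (c.term j) with hf
  have hmono : ∀ j < c.length, f (j + 1) ≤ f j := fun j hj => Submodule.finrank_mono (c.step_le j hj)
  have hle : c.qtDim ≤ ∑ j ∈ Finset.range c.length, (f j - f (j + 1)) :=
    Finset.sum_le_sum fun j _ => by split_ifs <;> simp [hf]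
  refine hle.trans ?_
  have h0 : f 0 = Module.finrank K M := by
    show Module.finrank K (c.term 0) = _
    rw [c.term_zero, finrank_top]
  have hZ : ((∑ j ∈ Finset.range c.length, (f j - f (j + 1)) : ℕ) : ℤ) = f 0 - f c.length := by
    rw [Nat.cast_sum, Finset.sum_congr rfl fun j hj =>
      Nat.cast_sub (R := ℤ) (hmono j (Finset.mem_range.1 hj)), Finset.sum_range_sub']
  have key : ((∑ j ∈ Finset.range c.length, (f j - f (j + 1)) : ℕ) : ℤ) ≤ (Module.finrank K M : ℕ) := by
    rw [hZ, ← h0]; have := Int.natCast_nonneg (f c.length); omega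
  exact_mod_cast key

/-- Quasi-trivial dimensions of filtrations are bounded by `dim M`. [cite: MochizukiAbsTopI2012, Lemma 4.5 (ii) p.54] -/
theorem bddAbove_range_qtDim [FiniteDimensional K M] (ρ : G →* (M ≃ₗ[K] M)) :
    BddAbove (Set.range (StableChain.qtDim (ρ := ρ))) :=
  ⟨Module.finrank K M, by rintro _ ⟨c, rfl⟩; exact c.qtDim_le⟩

/-- Every filtration's quasi-trivial dimension is `≤ τ(M)`. [cite: MochizukiAbsTopI2012, Lemma 4.5 (ii) p.54] -/
theorem StableChain.qtDim_le_quasiTrivialRank [FiniteDimensional K M] {ρ : G →* (M ≃ₗ[K] M)}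
    (c : StableChain ρ) : c.qtDim ≤ quasiTrivialRank ρ :=
  le_csSup (bddAbove_range_qtDim ρ) ⟨c, rfl⟩

/-- `τ(M) ≤ dim M`. [cite: MochizukiAbsTopI2012, Lemma 4.5 (ii) p.54] -/
theorem quasiTrivialRank_le_finrank [FiniteDimensional K M] (ρ : G →* (M ≃ₗ[K] M)) :
    quasiTrivialRank ρ ≤ Module.finrank K M :=
  csSup_le ⟨_, ⟨StableChain.trivial ρ, rfl⟩⟩ (by rintro _ ⟨c, rfl⟩; exact c.qtDim_le)

/-! ### `d_χ(M)` and Lemma 4.5 (ii) -/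

/-- "`d_χ(M) := τ(M(χ⁻¹)) − τ(Hom_{ℚ_l}(M, ℚ_l))`" ([AbsTopI] Lemma 4.5 (ii) p. 54), an integer.
[cite: MochizukiAbsTopI2012, Lemma 4.5 (ii) p.54] -/
def dChi (ρ : G →* (M ≃ₗ[K] M)) (χ : G →* Kˣ) : ℤ :=
  (quasiTrivialRank (twist ρ χ⁻¹) : ℤ) - quasiTrivialRank (dualRep ρ)

/-- Twisting by `χ` trivial on an open subgroup of finite index keeps quasi-trivial steps
quasi-trivial. [cite: MochizukiAbsTopI2012, Lemma 4.5 (ii) p.54] -/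
theorem isQuasiTrivialStep_twist_of_trivialOn {ρ : G →* (M ≃ₗ[K] M)} {χ : G →* Kˣ}
    {U₀ : Subgroup G} (hU₀ : IsOpen (U₀ : Set G)) [U₀.FiniteIndex] (hχ : ∀ g ∈ U₀, χ g = 1)
    (N N' : Submodule K M) (h : IsQuasiTrivialStep ρ N N') : IsQuasiTrivialStep (twist ρ χ) N N' := by
  obtain ⟨U, hU, hUfin, hact⟩ := h
  haveI := hUfin
  refine ⟨U ⊓ U₀, hU.inter hU₀, inferInstance, fun g hg m hm => ?_⟩
  rw [twist_apply, hχ g hg.2, Units.val_one, one_smul]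
  exact hact g hg.1 m hm

/-- `τ` does not decrease under such a twist. [cite: MochizukiAbsTopI2012, Lemma 4.5 (ii) p.54] -/
theorem quasiTrivialRank_le_twist [FiniteDimensional K M] (ρ : G →* (M ≃ₗ[K] M)) {χ : G →* Kˣ}
    {U₀ : Subgroup G} (hU₀ : IsOpen (U₀ : Set G)) [U₀.FiniteIndex] (hχ : ∀ g ∈ U₀, χ g = 1) :
    quasiTrivialRank ρ ≤ quasiTrivialRank (twist ρ χ) := by
  refine csSup_le ⟨_, ⟨StableChain.trivial ρ, rfl⟩⟩ ?_
  rintro _ ⟨c, rfl⟩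
  let c' : StableChain (twist ρ χ) :=
    { length := c.length, term := c.term, term_zero := c.term_zero, term_length := c.term_length,
      step_le := c.step_le, stable := fun j => (isStable_twist_iff ρ χ _).2 (c.stable j) }
  have hle : c.qtDim ≤ c'.qtDim := by
    unfold StableChain.qtDim
    refine Finset.sum_le_sum fun j _ => ?_
    by_cases hq : IsQuasiTrivialStep ρ (c.term j) (c.term (j + 1))
    · have hq' : IsQuasiTrivialStep (twist ρ χ) (c'.term j) (c'.term (j + 1)) :=
        isQuasiTrivialStep_twist_of_trivialOn hU₀ hχ _ _ hq
      rw [if_pos hq, if_pos hq']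
    · rw [if_neg hq]; exact Nat.zero_le _
  exact hle.trans c'.qtDim_le_quasiTrivialRank

/-- `τ(M(χ)) = τ(M)` for `χ` trivial on an open subgroup of finite index. [cite: MochizukiAbsTopI2012, Lemma 4.5 (ii) p.54] -/
theorem quasiTrivialRank_twist_eq [FiniteDimensional K M] (ρ : G →* (M ≃ₗ[K] M)) {χ : G →* Kˣ}
    {U₀ : Subgroup G} (hU₀ : IsOpen (U₀ : Set G)) [U₀.FiniteIndex] (hχ : ∀ g ∈ U₀, χ g = 1) :
    quasiTrivialRank (twist ρ χ) = quasiTrivialRank ρ := by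
  refine le_antisymm ?_ (quasiTrivialRank_le_twist ρ hU₀ hχ)
  have hχ' : ∀ g ∈ U₀, χ⁻¹ g = 1 := fun g hg => by simp [hχ g hg]
  have h := quasiTrivialRank_le_twist (twist ρ χ) hU₀ hχ'
  have e : χ * χ⁻¹ = 1 := by ext g; simp
  rwa [twist_twist, e, twist_one] at h

/-- A continuous character with `ψⁿ = 1` has an open kernel of finite index (its values are `n`-th
roots of unity, a finite set; the kernel is closed). [cite: MochizukiAbsTopI2012, Lemma 4.5 (ii) p.54] -/
theorem isOpen_ker_of_pow_eq_one [IsTopologicalGroup G] [TopologicalSpace K] [T1Space K]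
    (ψ : G →* Kˣ) (hψ : Continuous fun g => (ψ g : K)) {n : ℕ} (hn : 0 < n)
    (h : ∀ g, ψ g ^ n = 1) : IsOpen (ψ.ker : Set G) ∧ ψ.ker.FiniteIndex := by
  have hfin : (Set.range fun g => (ψ g : K)).Finite := by
    refine (Polynomial.nthRoots n (1 : K)).toFinset.finite_toSet.subset ?_
    rintro _ ⟨g, rfl⟩
    simp only [Finset.mem_coe, Multiset.mem_toFinset, Polynomial.mem_nthRoots hn]
    have := congrArg (fun u : Kˣ => (u : K)) (h g)
    simpa using this
  have hfin' : (Set.range ψ).Finite := by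
    refine Set.Finite.of_finite_image ?_ (fun a _ b _ hab => Units.ext hab)
    rw [← Set.range_comp]
    exact hfin
  haveI : Finite ψ.range := by
    exact (show (ψ.range : Set Kˣ).Finite by rw [MonoidHom.coe_range]; exact hfin').to_subtype
  have hclosed : IsClosed (ψ.ker : Set G) := by
    have : (ψ.ker : Set G) = (fun g => (ψ g : K)) ⁻¹' {1} := by
      ext g
      simp only [SetLike.mem_coe, MonoidHom.mem_ker, Set.mem_preimage, Set.mem_singleton_iff,
        Units.ext_iff, Units.val_one]
    rw [this]
    exact isClosed_singleton.preimage hψ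
  exact ⟨ψ.ker.isOpen_of_isClosed_of_finiteIndex hclosed, inferInstance⟩

/-- **[AbsTopI] Lemma 4.5 (ii), the assertion** — PROVED: "`d_χ(M)`, regarded as a function of
`χ`, depends only on the power-equivalence class of `χ`", for continuous characters of the
topological group `G` with values in a `T₁` topological field `K` (e.g. `ℚ_l`); power-equivalence
("the `n`-th powers of the two characters coincide" for some `n > 0`) is written out — it is
`AbsTopIII.PowerEquivalent` (abc-iut-L4-t1) / t4's `PowerEquivalent` for `ℤ_l^×`-valued characters.
[cite: MochizukiAbsTopI2012, Lemma 4.5 (ii) p.54] -/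
theorem dChi_eq_of_powerEquivalent [FiniteDimensional K M] [IsTopologicalGroup G]
    [TopologicalSpace K] [T1Space K] [ContinuousMul K] (ρ : G →* (M ≃ₗ[K] M))
    {χ₁ χ₂ : G →* Kˣ} (hχ₁ : Continuous χ₁) (hχ₂ : Continuous χ₂)
    (h : ∃ n : ℕ, 0 < n ∧ ∀ g : G, χ₁ g ^ n = χ₂ g ^ n) : dChi ρ χ₁ = dChi ρ χ₂ := by
  obtain ⟨n, hn, hpow⟩ := h
  -- `ψ := χ₂ χ₁⁻¹` satisfies `ψⁿ = 1`
  set ψ : G →* Kˣ := χ₂ * χ₁⁻¹ with hψdef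
  have hψn : ∀ g, ψ g ^ n = 1 := fun g => by
    simp only [hψdef, MonoidHom.mul_apply, MonoidHom.inv_apply, mul_pow, inv_pow, ← hpow g, mul_inv_cancel]
  have hψc : Continuous fun g => (ψ g : K) := by
    have : (ψ : G → Kˣ) = fun g => χ₂ g * (χ₁ g)⁻¹ := by ext g; simp [hψdef]
    exact Units.continuous_val.comp (by rw [this]; exact hχ₂.mul hχ₁.inv)
  obtain ⟨hopen, hfi⟩ := isOpen_ker_of_pow_eq_one ψ hψc hn hψn
  haveI := hfi
  have hker : ∀ g ∈ ψ.ker, ψ g = 1 := fun g hg => hg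
  -- `M(χ₁⁻¹) = M(χ₂⁻¹)(ψ)` and `ψ` is trivial on `Ker ψ`
  have e : χ₂⁻¹ * ψ = χ₁⁻¹ := by
    ext g; simp [hψdef]
  have htw : twist ρ χ₁⁻¹ = twist (twist ρ χ₂⁻¹) ψ := by rw [twist_twist, e]
  unfold dChi
  rw [htw, quasiTrivialRank_twist_eq _ hopen hker]

/-! ### Lemma 4.5 (iii) as predicates on abstract data (typing policy θ) -/

variable {V : Type w'} [AddCommGroup V] [Module K V]

/-- A weight `w` is *realised* (relative to `χ^{cyclo}` and the `G`-module `V = H^{ab} ⊗ ℚ_l`) if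
some `ℚ`-cyclotomic character `χ•` of weight `w` has "`τ(M(χ•⁻¹)) ≠ 0` for some subquotient
`G`-module `M` of `(H^{ab} ⊗ ℚ_l) ⊕ ℚ_l`" ([AbsTopI] Lemma 4.5 (iii) p. 54) — equivalently (a
quasi-trivial subquotient of a subquotient is one of the whole module) `τ` of the twisted
`V ⊕ K` itself is nonzero. [cite: MochizukiAbsTopI2012, Lemma 4.5 (iii) p.54] -/
def RealisedWeight (χcyclo : G →* Kˣ) (ρV : G →* (V ≃ₗ[K] V)) (w : ℚ) : Prop :=
  ∃ χ : G →* Kˣ, IsQCyclotomicOfWeightK χcyclo χ w ∧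
    quasiTrivialRank (twist (withTrivial ρV) χ⁻¹) ≠ 0

/-- [AbsTopI] Lemma 4.5 (iii), first assertion, as a predicate on the input data `(χ^{cyclo}, V)`
with `V` "the `G`-module `H^{ab} ⊗ ℚ_l`, where `H ⊆ Δ` is a torsion-free pro-`Σ` characteristic open
subgroup such that `H^{ab} ⊗ ℚ_l ≠ 0`" (supplied by a model): "the character `G → ℤ_l^×` arising
from the determinant of [`V`] is `ℚ`-cyclotomic of positive weight".
[cite: MochizukiAbsTopI2012, Lemma 4.5 (iii) p.54] -/
def Lem45iii_det (χcyclo : G →* Kˣ) (ρV : G →* (V ≃ₗ[K] V)) : Prop :=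
  ∃ w : ℚ, 0 < w ∧ IsQCyclotomicOfWeightK χcyclo (detChar ρV) w

/-- [AbsTopI] Lemma 4.5 (iii), second assertion, as a predicate on `(χ^{cyclo}, V)` ("for every
sufficiently small characteristic open subgroup `H ⊆ Δ`", a model-side hypothesis): "the
power-equivalence class of the cyclotomic character `χ^{cyclo}_G` may be characterized as the
unique power-equivalence class of characters `χ : G → ℤ_l^×` of the form `χ = χ^* · χ_*`, where
`χ^*` (respectively, `χ_*`) is a `ℚ`-cyclotomic character of maximal (respectively, minimal)
weight such that `τ(M(χ•⁻¹)) ≠ 0` for some subquotient `G`-module `M` of `(H^{ab} ⊗ ℚ_l) ⊕ ℚ_l`":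
the realised weights have a maximum and a minimum, and every product of a realiser of the maximum
with a realiser of the minimum is power-equivalent to `χ^{cyclo}`.
[cite: MochizukiAbsTopI2012, Lemma 4.5 (iii) p.54] -/
def Lem45iii_cycloClass (χcyclo : G →* Kˣ) (ρV : G →* (V ≃ₗ[K] V)) : Prop :=
  ∃ wmax wmin : ℚ, IsGreatest {w | RealisedWeight χcyclo ρV w} wmax ∧
    IsLeast {w | RealisedWeight χcyclo ρV w} wmin ∧
    ∀ χup χlow : G →* Kˣ,
      IsQCyclotomicOfWeightK χcyclo χup wmax → quasiTrivialRank (twist (withTrivial ρV) χup⁻¹) ≠ 0 →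
      IsQCyclotomicOfWeightK χcyclo χlow wmin → quasiTrivialRank (twist (withTrivial ρV) χlow⁻¹) ≠ 0 →
        ∃ n : ℕ, 0 < n ∧ ∀ g : G, χcyclo g ^ n = (χup * χlow) g ^ n

/-- [AbsTopI] Lemma 4.5 (iii), third assertion, as a predicate on `(χ^{cyclo}, V)` and the number
`numCusps` of cusps of the covering of `X ×_k k̃` determined by `H` (t4's `CuspCountData`): "if
`χ = χ^{cyclo}_G`, then the divisor of cusps [...] is a disjoint union of `d_χ(H^{ab} ⊗ ℚ_l) + 1`
copies of `Spec(k̃)`". [cite: MochizukiAbsTopI2012, Lemma 4.5 (iii) p.54] -/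
def Lem45iii_cuspCount (χcyclo : G →* Kˣ) (ρV : G →* (V ≃ₗ[K] V)) (numCusps : ℕ) : Prop :=
  (numCusps : ℤ) = dChi ρV χcyclo + 1

end Topological

end Literature.AnabelianGeometry.AbsoluteAnabelian.AbsTopI
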